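import Summits.Ventures.PercRepro.RankLevelSetRuleQSliceFirstUntrunc
import Summits.Ventures.PercRepro.RankLevelSetRuleQSliceRho

/-!
# PercRepro — THE CELL `m = 2` OF THE FIRST UNTRUNCATED SLICE; THE SLICE `u = k − 1` ON ITS WHOLE BOTTOM REGIME
(night-1, gen 21; dossier §32.2)

At `u = k − 1`, `m = 2` (`q = k + 1`; `k = L + 1`) the tail `T'(2, k) = sliceTail L (L+1) 2` exceeds `1` from `k ≈ 15` on
(`→ 9/8`), so the cell needs the ρ-slack of the slice identity (the template of RankLevelSetRuleQSliceBorderFlatTwo):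
`R̂ − Φ = 1 + ρ(3k+2, k+1) − ρ(k+3, 2) − T'(2, k)` with
* **`rho_first_two_ge`** — `ρ(3L+5, L+2) ≥ 7/4` for `L ≥ 4` (the first four terms `1/2 + (1/2)(L+1)/(2L+5) + … ≥ 3/4`);
* **`rho_two_le`** — `ρ(L+4, 2) = 1 + 2(L+5)/((L+3)(L+4)) ≤ 37/28` for `L ≥ 4`;
* **`sliceTail_first_two_le (L) : sliceTail L (L+1) 2 ≤ 9/8`** for EVERY `L` (the terms `secondTerm L i` contract by
  `r₂(L) = L(L+4)/((L+2)(2L+6))`, `secondTerm L 0 = (L+2)(9L+23)/(4(2L+3)(2L+5))`, and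
  `36(2L+3)(2L+5)(L²+6L+12) − 16(L+2)²(L+3)(9L+23) = 64L³ + 844L² + 2536L + 2064 ≥ 0`);
hence `9/8 ≤ 1 + 7/4 − 37/28 = 10/7`, and
* **`first_untrunc_two (k) (5 ≤ k) : Φ(2k+1, k+1) ≤ R̂(k+1, k, 2)`** — the cell `q = k + 1` of the slice `u = k − 1`;
* **`first_untrunc_slice_complete (k q) (5 ≤ k) (k − 1 ≤ q) (q + 1 ≤ k²) : Φ(q+k, q) ≤ R̂(q, k, q − (k−1))`** — THE FIRST
  UNTRUNCATED SLICE IS PAID ON ITS WHOLE BOTTOM REGIME `k − 1 ≤ q ≤ k² − 1`, EVERY FAMILY `k ≥ 5` (with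
  `first_untrunc_slice_all`); `ruleQRecv_ge_phiK_first_untrunc_complete` is the matroid level.
Twin: mining/night-1/g21/firstuntr_m2.py (exact margins `0.54 (k = 5) … 0.85`, the crude chain `≥ 0.44`). Axioms: standard.
-/

namespace PercRepro

open Set Matroid Finset

/-- The `i`-th term of `T'(2) = sliceTail L (L+1) 2` (`j = L + 1 + i`, `q = 2 + L`). -/
def secondTerm (L i : ℕ) : ℚ :=
  ((2 * L + 1).choose (L + 1 + i) : ℚ)
    * ∑ a ∈ range (2 + 1), ((2 : ℕ).choose a : ℚ) / ((2 + L + (L + 1 + i) + a).choose (a + (L + 1 + i)) : ℚ)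

/-- `sliceTail L (L+1) 2 = Σ_{i ≤ L} secondTerm L i`. -/
lemma sliceTail_second_eq (L : ℕ) : sliceTail L (L + 1) 2 = ∑ i ∈ range (L + 1), secondTerm L i := by
  unfold sliceTail secondTerm
  have h : Finset.Icc (L + 1) (L + (L + 1)) = Finset.Ico (L + 1) (2 * L + 1 + 1) := by
    ext j; simp only [Finset.mem_Icc, Finset.mem_Ico]; omega
  rw [h, Finset.sum_Ico_eq_sum_range, show 2 * L + 1 + 1 - (L + 1) = L + 1 by omega, show L + (L + 1) = 2 * L + 1 by ring]

/-- The terms are nonnegative. -/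
lemma secondTerm_nonneg (L i : ℕ) : 0 ≤ secondTerm L i := by
  unfold secondTerm
  apply mul_nonneg (by positivity)
  apply Finset.sum_nonneg
  intro a _
  positivity

/-- The contraction ratio `r₂(L) = L(L+4)/((L+2)(2L+6))`. -/
def secondRatio (L : ℕ) : ℚ := ((L : ℚ) * ((L : ℚ) + 4)) / (((L : ℚ) + 2) * (2 * (L : ℚ) + 6))

/-- `r₂(L) ≥ 0`. -/
lemma secondRatio_nonneg (L : ℕ) : 0 ≤ secondRatio L := by unfold secondRatio; positivity

/-- `r₂(L) < 1/2`. -/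
lemma secondRatio_lt_half (L : ℕ) : secondRatio L < 1 / 2 := by
  unfold secondRatio
  rw [div_lt_iff₀ (by positivity)]
  have : (0 : ℚ) ≤ L := by positivity
  nlinarith

/-- **The terms of `T'(2)` contract**: `secondTerm L (i+1) ≤ r₂(L) · secondTerm L i` for `i + 1 ≤ L` (termwise in `a ≤ 2`:
the `a`-factor `(L+2+i+a)/(2L+4+i+a) ≤ (L+4+i)/(2L+6+i)` and `(L−i)(L+4+i)/((L+2+i)(2L+6+i)) ≤ r₂(L)`). -/
lemma secondTerm_succ_le (L i : ℕ) (hi : i + 1 ≤ L) : secondTerm L (i + 1) ≤ secondRatio L * secondTerm L i := by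
  unfold secondTerm
  rw [Finset.mul_sum, Finset.mul_sum, Finset.mul_sum]
  apply Finset.sum_le_sum
  intro a ha
  rw [Finset.mem_range] at ha
  rw [show L + 1 + (i + 1) = L + 1 + i + 1 by ring,
    show 2 + L + (L + 1 + i + 1) + a = 2 + L + (L + 1 + i) + a + 1 by ring,
    show a + (L + 1 + i + 1) = a + (L + 1 + i) + 1 by ring]
  have h1 := Nat.choose_succ_right_eq (2 * L + 1) (L + 1 + i)
  rw [show 2 * L + 1 - (L + 1 + i) = L - i by omega] at h1
  have hc1 := congrArg (fun x : ℕ => (x : ℚ)) h1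
  push_cast [Nat.cast_sub (by omega : i ≤ L)] at hc1
  have h2 := Nat.add_one_mul_choose_eq (2 + L + (L + 1 + i) + a) (a + (L + 1 + i))
  have hc2 := congrArg (fun x : ℕ => (x : ℚ)) h2
  push_cast at hc2
  have hB : (0 : ℚ) < ((2 + L + (L + 1 + i) + a).choose (a + (L + 1 + i)) : ℚ) :=
    Nat.cast_pos.mpr (Nat.choose_pos (by omega))
  have hB' : (0 : ℚ) < ((2 + L + (L + 1 + i) + a + 1).choose (a + (L + 1 + i) + 1) : ℚ) :=
    Nat.cast_pos.mpr (Nat.choose_pos (by omega))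
  have hiL : (i : ℚ) + 1 ≤ L := by exact_mod_cast hi
  have ha2 : (a : ℚ) ≤ 2 := by exact_mod_cast (by omega : a ≤ 2)
  have ha0 : (0 : ℚ) ≤ a := by positivity
  have hi0 : (0 : ℚ) ≤ i := by positivity
  have hL0 : (0 : ℚ) ≤ L := by positivity
  have hpos1 : (0 : ℚ) < (L : ℚ) + 1 + i + 1 := by positivity
  have e1 : ((2 * L + 1).choose (L + 1 + i + 1) : ℚ)
      = ((2 * L + 1).choose (L + 1 + i) : ℚ) * (((L : ℚ) - i) / ((L : ℚ) + 1 + i + 1)) := by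
    rw [mul_div_assoc', eq_div_iff hpos1.ne']; linarith [hc1]
  have e2 : (1 : ℚ) / ((2 + L + (L + 1 + i) + a + 1).choose (a + (L + 1 + i) + 1) : ℚ)
      = ((((a + (L + 1 + i) : ℕ) : ℚ) + 1) / (((2 + L + (L + 1 + i) + a : ℕ) : ℚ) + 1))
          * (1 / ((2 + L + (L + 1 + i) + a).choose (a + (L + 1 + i)) : ℚ)) := by
    rw [div_mul_div_comm, mul_one, div_eq_div_iff hB'.ne' (mul_pos (by positivity) hB).ne']
    push_cast
    linarith [hc2]
  have hr : (((L : ℚ) - i) / ((L : ℚ) + 1 + i + 1))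
      * ((((a + (L + 1 + i) : ℕ) : ℚ) + 1) / (((2 + L + (L + 1 + i) + a : ℕ) : ℚ) + 1)) ≤ secondRatio L := by
    push_cast
    have hA : ((a : ℚ) + (L + 1 + i) + 1) / (2 + (L : ℚ) + (L + 1 + i) + a + 1) ≤ ((L : ℚ) + 4 + i) / (2 * L + 6 + i) := by
      rw [div_le_div_iff₀ (by positivity) (by positivity)]
      nlinarith [mul_nonneg (by linarith : (0 : ℚ) ≤ 2 - a) (by positivity : (0 : ℚ) ≤ (L : ℚ) + 2)]
    have hP : (((L : ℚ) - i) / ((L : ℚ) + 1 + i + 1)) * (((L : ℚ) + 4 + i) / (2 * L + 6 + i)) ≤ secondRatio L := by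
      unfold secondRatio
      rw [div_mul_div_comm, div_le_div_iff₀ (by positivity) (by positivity)]
      have key : (L : ℚ) * (L + 4) * ((L + 1 + i + 1) * (2 * L + 6 + i)) - ((L : ℚ) - i) * (L + 4 + i) * ((L + 2) * (2 * L + 6))
          = (L : ℚ) * (L + 4) * (i * (3 * L + 8) + i ^ 2) + (4 * i + i ^ 2) * (L + 2) * (2 * L + 6) := by ring
      have : (0 : ℚ) ≤ (L : ℚ) * (L + 4) * (i * (3 * L + 8) + i ^ 2) + (4 * i + i ^ 2) * (L + 2) * (2 * L + 6) := by
        positivity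
      linarith
    have hLi : (0 : ℚ) ≤ ((L : ℚ) - i) / ((L : ℚ) + 1 + i + 1) := by
      apply div_nonneg _ (by positivity); linarith
    calc (((L : ℚ) - i) / ((L : ℚ) + 1 + i + 1)) * (((a : ℚ) + (L + 1 + i) + 1) / (2 + (L : ℚ) + (L + 1 + i) + a + 1))
        ≤ (((L : ℚ) - i) / ((L : ℚ) + 1 + i + 1)) * (((L : ℚ) + 4 + i) / (2 * L + 6 + i)) :=
          mul_le_mul_of_nonneg_left hA hLi
      _ ≤ secondRatio L := hP
  rw [div_eq_mul_one_div (((2 : ℕ).choose a : ℚ)), div_eq_mul_one_div (((2 : ℕ).choose a : ℚ)), e1, e2]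
  calc ((2 * L + 1).choose (L + 1 + i) : ℚ) * (((L : ℚ) - i) / ((L : ℚ) + 1 + i + 1))
        * (((2 : ℕ).choose a : ℚ) * (((((a + (L + 1 + i) : ℕ) : ℚ) + 1) / (((2 + L + (L + 1 + i) + a : ℕ) : ℚ) + 1))
          * (1 / ((2 + L + (L + 1 + i) + a).choose (a + (L + 1 + i)) : ℚ))))
      = (((2 * L + 1).choose (L + 1 + i) : ℚ) * (((2 : ℕ).choose a : ℚ)
          * (1 / ((2 + L + (L + 1 + i) + a).choose (a + (L + 1 + i)) : ℚ))))
        * ((((L : ℚ) - i) / ((L : ℚ) + 1 + i + 1))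
          * ((((a + (L + 1 + i) : ℕ) : ℚ) + 1) / (((2 + L + (L + 1 + i) + a : ℕ) : ℚ) + 1))) := by ring
    _ ≤ (((2 * L + 1).choose (L + 1 + i) : ℚ) * (((2 : ℕ).choose a : ℚ)
          * (1 / ((2 + L + (L + 1 + i) + a).choose (a + (L + 1 + i)) : ℚ)))) * secondRatio L :=
        mul_le_mul_of_nonneg_left hr (by positivity)
    _ = _ := by ring

/-- `secondTerm L i ≤ secondTerm L 0 · r₂(L)^i` for `i ≤ L`. -/
lemma secondTerm_le_geom (L : ℕ) : ∀ i : ℕ, i ≤ L → secondTerm L i ≤ secondTerm L 0 * secondRatio L ^ i := by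
  intro i
  induction i with
  | zero => intro _; simp
  | succ i ih =>
    intro hi
    calc secondTerm L (i + 1) ≤ secondRatio L * secondTerm L i := secondTerm_succ_le L i hi
      _ ≤ secondRatio L * (secondTerm L 0 * secondRatio L ^ i) :=
          mul_le_mul_of_nonneg_left (ih (by omega)) (secondRatio_nonneg L)
      _ = secondTerm L 0 * secondRatio L ^ (i + 1) := by ring

/-- **The first term of `T'(2)` exactly**: `secondTerm L 0 = (L+2)(9L+23)/(4(2L+3)(2L+5))`
(`C(2L+1, L+1)/C(2L+3, L+1) = (L+2)/(2(2L+3))`, `C(2L+4, L+2) = 2·C(2L+3, L+1)`, `C(2L+5, L+3) = ((2L+5)/(L+3))·C(2L+4, L+2)`). -/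
lemma secondTerm_zero_eq (L : ℕ) :
    secondTerm L 0 = (((L : ℚ) + 2) * (9 * (L : ℚ) + 23)) / (4 * (2 * (L : ℚ) + 3) * (2 * (L : ℚ) + 5)) := by
  unfold secondTerm
  simp only [Finset.sum_range_succ, Finset.sum_range_zero, Nat.add_zero, zero_add]
  rw [show 2 + L + (L + 1) = 2 * L + 3 by ring, show 2 * L + 3 + 1 = 2 * L + 4 by ring,
    show 2 * L + 3 + 2 = 2 * L + 5 by ring, show 1 + (L + 1) = L + 2 by ring, show 2 + (L + 1) = L + 3 by ring]
  simp only [Nat.choose_zero_right, Nat.choose_one_right, Nat.choose_self, Nat.cast_one, Nat.cast_ofNat]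
  have r1 := Nat.choose_mul_succ_eq (2 * L + 1) (L + 1)
  have r2 := Nat.choose_mul_succ_eq (2 * L + 2) (L + 1)
  rw [show 2 * L + 1 + 1 - (L + 1) = L + 1 by omega, show 2 * L + 1 + 1 = 2 * L + 2 by ring] at r1
  rw [show 2 * L + 2 + 1 - (L + 1) = L + 2 by omega, show 2 * L + 2 + 1 = 2 * L + 3 by ring] at r2
  have s1 := Nat.add_one_mul_choose_eq (2 * L + 3) (L + 1)
  have s2 := Nat.add_one_mul_choose_eq (2 * L + 4) (L + 2)
  rw [show 2 * L + 3 + 1 = 2 * L + 4 by ring, show L + 1 + 1 = L + 2 by ring] at s1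
  rw [show 2 * L + 4 + 1 = 2 * L + 5 by ring, show L + 2 + 1 = L + 3 by ring] at s2
  have c1 := congrArg (fun x : ℕ => (x : ℚ)) r1
  have c2 := congrArg (fun x : ℕ => (x : ℚ)) r2
  have d1 := congrArg (fun x : ℕ => (x : ℚ)) s1
  have d2 := congrArg (fun x : ℕ => (x : ℚ)) s2
  push_cast at c1 c2 d1 d2
  clear r1 r2 s1 s2
  have hA : (0 : ℚ) < ((2 * L + 1).choose (L + 1) : ℚ) := Nat.cast_pos.mpr (Nat.choose_pos (by omega))
  have hB0 : (0 : ℚ) < ((2 * L + 3).choose (L + 1) : ℚ) := Nat.cast_pos.mpr (Nat.choose_pos (by omega))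
  have hB1 : (0 : ℚ) < ((2 * L + 4).choose (L + 2) : ℚ) := Nat.cast_pos.mpr (Nat.choose_pos (by omega))
  have hB2 : (0 : ℚ) < ((2 * L + 5).choose (L + 3) : ℚ) := Nat.cast_pos.mpr (Nat.choose_pos (by omega))
  have hL : (0 : ℚ) ≤ L := by positivity
  have hL1 : (0 : ℚ) < (L : ℚ) + 1 := by positivity
  have hL2 : (0 : ℚ) < (L : ℚ) + 2 := by positivity
  have hL3 : (0 : ℚ) < (L : ℚ) + 3 := by positivity
  set A : ℚ := ((2 * L + 1).choose (L + 1) : ℚ) with hAdef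
  set B₀ : ℚ := ((2 * L + 3).choose (L + 1) : ℚ) with hB0def
  set B₁ : ℚ := ((2 * L + 4).choose (L + 2) : ℚ) with hB1def
  set B₂ : ℚ := ((2 * L + 5).choose (L + 3) : ℚ) with hB2def
  -- A · 2(2L+3) = B₀ · (L+2)
  have eA : A * (2 * (2 * (L : ℚ) + 3)) = B₀ * ((L : ℚ) + 2) := by
    have key : A * ((2 * (L : ℚ) + 2) * (2 * L + 3)) = B₀ * (((L : ℚ) + 1) * (L + 2)) := by
      linear_combination (2 * (L : ℚ) + 3) * c1 + ((L : ℚ) + 1) * c2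
    have h : (A * (2 * (2 * (L : ℚ) + 3))) * ((L : ℚ) + 1) = (B₀ * ((L : ℚ) + 2)) * ((L : ℚ) + 1) := by
      linear_combination key
    exact mul_right_cancel₀ hL1.ne' h
  have eB1 : B₁ = 2 * B₀ := by
    have h : B₁ * ((L : ℚ) + 2) = (2 * B₀) * ((L : ℚ) + 2) := by linear_combination -d1
    exact mul_right_cancel₀ hL2.ne' h
  have eB2 : B₂ = ((2 * (L : ℚ) + 5) / ((L : ℚ) + 3)) * B₁ := by
    rw [div_mul_eq_mul_div, eq_div_iff hL3.ne']; linear_combination -d2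
  rw [eB2, eB1]
  have eA' : A = B₀ * ((L : ℚ) + 2) / (2 * (2 * (L : ℚ) + 3)) := by
    rw [eq_div_iff (by positivity)]; exact eA
  rw [eA']
  have hB0' : B₀ ≠ 0 := hB0.ne'
  have h23 : (2 * (L : ℚ) + 3) ≠ 0 := by positivity
  have h25 : (2 * (L : ℚ) + 5) ≠ 0 := by positivity
  have hL3' : (L : ℚ) + 3 ≠ 0 := hL3.ne'
  field_simp
  ring

/-- `Σ_{i<n} r^i ≤ 1/(1 − r)` for `0 ≤ r < 1` (restated locally). -/
lemma sum_geom_le_inv' (r : ℚ) (h0 : 0 ≤ r) (h1 : r < 1) (n : ℕ) : ∑ i ∈ range n, r ^ i ≤ 1 / (1 - r) :=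
  sum_geom_le_inv r h0 h1 n

/-- **`T'(2, k) ≤ 9/8` for every family** (`k = L + 1`): `Σ_i secondTerm L i ≤ secondTerm L 0/(1 − r₂(L))` and
`(L+2)(9L+23)/(4(2L+3)(2L+5)) · (L+2)(2L+6)/(L²+6L+12) ≤ 9/8` (`64L³ + 844L² + 2536L + 2064 ≥ 0`). -/
theorem sliceTail_first_two_le (L : ℕ) : sliceTail L (L + 1) 2 ≤ 9 / 8 := by
  rw [sliceTail_second_eq]
  have h0 := secondTerm_nonneg L 0
  have hr0 := secondRatio_nonneg L
  have hr1 : secondRatio L < 1 := (secondRatio_lt_half L).trans (by norm_num)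
  have hsum : ∑ i ∈ range (L + 1), secondTerm L i ≤ secondTerm L 0 * (1 / (1 - secondRatio L)) := by
    calc ∑ i ∈ range (L + 1), secondTerm L i ≤ ∑ i ∈ range (L + 1), secondTerm L 0 * secondRatio L ^ i := by
          apply Finset.sum_le_sum
          intro i hi
          rw [Finset.mem_range] at hi
          exact secondTerm_le_geom L i (by omega)
      _ = secondTerm L 0 * ∑ i ∈ range (L + 1), secondRatio L ^ i := by rw [Finset.mul_sum]
      _ ≤ secondTerm L 0 * (1 / (1 - secondRatio L)) :=
          mul_le_mul_of_nonneg_left (sum_geom_le_inv' (secondRatio L) hr0 hr1 (L + 1)) h0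
  have hL : (0 : ℚ) ≤ L := by positivity
  have hinv_eq : 1 / (1 - secondRatio L) = (((L : ℚ) + 2) * (2 * L + 6)) / ((L : ℚ) ^ 2 + 6 * L + 12) := by
    have h1 : 1 - secondRatio L = ((L : ℚ) ^ 2 + 6 * L + 12) / (((L : ℚ) + 2) * (2 * L + 6)) := by
      unfold secondRatio
      rw [eq_div_iff (by positivity), sub_mul, div_mul_cancel₀ _ (by positivity)]
      ring
    rw [h1, one_div_div]
  rw [secondTerm_zero_eq, hinv_eq] at hsum
  have hfinal : (((L : ℚ) + 2) * (9 * (L : ℚ) + 23)) / (4 * (2 * (L : ℚ) + 3) * (2 * (L : ℚ) + 5))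
      * ((((L : ℚ) + 2) * (2 * L + 6)) / ((L : ℚ) ^ 2 + 6 * L + 12)) ≤ 9 / 8 := by
    rw [div_mul_div_comm, div_le_div_iff₀ (by positivity) (by positivity)]
    have hpoly : (0 : ℚ) ≤ 64 * (L : ℚ) ^ 3 + 844 * (L : ℚ) ^ 2 + 2536 * L + 2064 := by positivity
    nlinarith [hpoly]
  exact hsum.trans hfinal

/-- **`ρ(3L+5, L+2) ≥ 7/4` for `L ≥ 4`**: the first four terms of `ρ − 1` are `1/2`, `(1/2)(L+1)/(2L+5)`,
`(1/2)(L+1)/(2L+5)·L/(2L+6)`, `·(L−1)/(2L+7)`, each nondecreasing in `L`, with sum `≥ 0.758` at `L = 4`. -/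
lemma rho_first_two_ge (L : ℕ) (hL : 4 ≤ L) :
    (7 : ℚ) / 4 ≤ (∑ i ∈ range (2 + L + 1), ((2 * (2 + L) + (L + 1)).choose i : ℚ)) / ((2 * (2 + L) + (L + 1)).choose (2 + L) : ℚ) := by
  rw [rho_as_prod_sum (2 * (2 + L) + (L + 1)) (2 + L) (by omega)]
  -- the first five terms s = 0 … 4
  have hsub : ∑ s ∈ range 5, ∏ t ∈ range s, ((((2 + L : ℕ) : ℚ) - t) / (((2 * (2 + L) + (L + 1) : ℕ) : ℚ) - ((2 + L : ℕ) : ℚ) + 1 + t))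
      ≤ ∑ s ∈ range (2 + L + 1), ∏ t ∈ range s, ((((2 + L : ℕ) : ℚ) - t) / (((2 * (2 + L) + (L + 1) : ℕ) : ℚ) - ((2 + L : ℕ) : ℚ) + 1 + t)) := by
    apply Finset.sum_le_sum_of_subset_of_nonneg (Finset.range_mono (by omega))
    intro s hs _
    rw [Finset.mem_range] at hs
    apply Finset.prod_nonneg
    intro t ht
    rw [Finset.mem_range] at ht
    have ht0 : (0 : ℚ) ≤ t := by positivity
    apply div_nonneg
    · push_cast
      have : (t : ℚ) ≤ 2 + (L : ℚ) := by exact_mod_cast (by omega : t ≤ 2 + L)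
      linarith
    · push_cast; linarith
  refine le_trans ?_ hsub
  simp only [Finset.sum_range_succ, Finset.sum_range_zero, Finset.prod_range_succ, Finset.prod_range_zero]
  push_cast
  have hL' : (4 : ℚ) ≤ L := by exact_mod_cast hL
  -- the four factors, bounded below by their values at L = 4
  have f1 : (2 + (L : ℚ) - 0) / (2 * (2 + L) + (L + 1) - (2 + L) + 1 + 0) = 1 / 2 := by
    rw [div_eq_iff (by linarith)]; ring
  have f2 : (5 : ℚ) / 13 ≤ (2 + (L : ℚ) - 1) / (2 * (2 + L) + (L + 1) - (2 + L) + 1 + 1) := by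
    rw [div_le_div_iff₀ (by norm_num) (by linarith)]; linarith
  have f3 : (4 : ℚ) / 14 ≤ (2 + (L : ℚ) - 2) / (2 * (2 + L) + (L + 1) - (2 + L) + 1 + 2) := by
    rw [div_le_div_iff₀ (by norm_num) (by linarith)]; linarith
  have f4 : (3 : ℚ) / 15 ≤ (2 + (L : ℚ) - 3) / (2 * (2 + L) + (L + 1) - (2 + L) + 1 + 3) := by
    rw [div_le_div_iff₀ (by norm_num) (by linarith)]; linarith
  have g2 : (0 : ℚ) ≤ (2 + (L : ℚ) - 1) / (2 * (2 + L) + (L + 1) - (2 + L) + 1 + 1) := by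
    apply div_nonneg <;> linarith
  have g3 : (0 : ℚ) ≤ (2 + (L : ℚ) - 2) / (2 * (2 + L) + (L + 1) - (2 + L) + 1 + 2) := by
    apply div_nonneg <;> linarith
  rw [f1]
  nlinarith [mul_le_mul f2 f3 (by norm_num) g2, mul_le_mul (mul_le_mul f2 f3 (by norm_num) g2) f4 (by norm_num)
    (mul_nonneg g2 g3)]

/-- **`ρ(L+4, 2) ≤ 37/28` for `L ≥ 4`**: `ρ(L+4, 2) = 1 + 2(L+5)/((L+3)(L+4))`. -/
lemma rho_two_le (L : ℕ) (hL : 4 ≤ L) :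
    (∑ i ∈ range (2 + 1), ((2 * 2 + L).choose i : ℚ)) / ((2 * 2 + L).choose 2 : ℚ) ≤ 37 / 28 := by
  simp only [Finset.sum_range_succ, Finset.sum_range_zero, Nat.choose_zero_right, Nat.choose_one_right, Nat.cast_one, zero_add]
  have h := Nat.add_one_mul_choose_eq (2 * 2 + L - 1) 1
  rw [show 2 * 2 + L - 1 + 1 = 2 * 2 + L by omega, Nat.choose_one_right] at h
  have hc := congrArg (fun x : ℕ => (x : ℚ)) h
  push_cast [Nat.cast_sub (by omega : 1 ≤ 2 * 2 + L)] at hc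
  have hC : (0 : ℚ) < ((2 * 2 + L).choose 2 : ℚ) := Nat.cast_pos.mpr (Nat.choose_pos (by omega))
  have hL' : (4 : ℚ) ≤ L := by exact_mod_cast hL
  rw [div_le_iff₀ hC]
  push_cast
  -- C(L+4, 2)·2 = (L+4)(L+3); then 56(L+5) ≤ 9(L+4)(L+3) ⟺ (L−4)(9L+43) ≥ 0
  nlinarith [hc, mul_nonneg (by linarith : (0 : ℚ) ≤ (L : ℚ) - 4) (by linarith : (0 : ℚ) ≤ 9 * (L : ℚ) + 43)]

/-- **The cell `m = 2` of the first untruncated slice, every family `k ≥ 5`**: `Φ(2k+1, k+1) ≤ R̂(k+1, k, 2)`. -/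
theorem first_untrunc_two (k : ℕ) (hk : 5 ≤ k) : phiK (k + 1 + k) (k + 1) ≤ rhat (k + 1) k 2 := by
  obtain ⟨L, rfl⟩ : ∃ L, k = L + 1 := ⟨k - 1, by omega⟩
  have h := phiK_le_rhat_of_sliceTail L (L + 1) 2 (by omega) (by
    have h1 := sliceTail_first_two_le L
    have h2 := rho_first_two_ge L (by omega)
    have h3 := rho_two_le L (by omega)
    linarith)
  rw [show L + 1 + 1 + (L + 1) = 2 + L + (L + 1) by ring, show L + 1 + 1 = 2 + L by ring]
  exact h

/-- **THE FIRST UNTRUNCATED SLICE ON ITS WHOLE BOTTOM REGIME, EVERY FAMILY `k ≥ 5`**: `k − 1 ≤ q ≤ k² − 1` ⇒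
`Φ(q+k, q) ≤ R̂(q, k, q − (k−1))`. -/
theorem first_untrunc_slice_complete (k q : ℕ) (hk : 5 ≤ k) (hq : k - 1 ≤ q) (hq' : q + 1 ≤ k * k) :
    phiK (q + k) q ≤ rhat q k (q - (k - 1)) := by
  rcases eq_or_ne q (k + 1) with h | h
  · subst h
    rw [show k + 1 - (k - 1) = 2 by omega]
    exact first_untrunc_two k hk
  · exact first_untrunc_slice_all k q (by omega) hq hq' h

/-- The matroid level of `first_untrunc_slice_complete`. -/
theorem ruleQRecv_ge_phiK_first_untrunc_complete {β : Type} (M : Matroid β) [M.Finite] {q k : ℕ} (hk : 5 ≤ k)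
    (hq : k - 1 ≤ q) (hq' : q + 1 ≤ k * k) (hE : M.E.ncard = (q + k) + q) {Z : Set β}
    (hZ : Z ∈ cellMembers M (q + k) q) (hP : (flatPart M Z).ncard = q - (k - 1)) :
    phiK (q + k) q ≤ ruleQRecv M (q + k) q Z := by
  have h1 := first_untrunc_slice_complete k q hk hq hq'
  have h2 := rhat_le_ruleQRecv M hE hZ
  rw [hP] at h2
  exact h1.trans h2

end PercRepro
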